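import Summits.KontsevichZagierPeriods.Zeta5Search.Certificates.VIMInnerModule
import HarnessLib

/-!
# ζ(5) search — brown9 LEVEL 1 (continued): the `n`-shift relation (N1) of the inner block `T(n;p,q)` (cell `pub-zeta5`, certifier `cert-1`)

HONEST FRAMING: systematic search; no irrationality claim unless certified.

Companion of `Certificates/VIMInnerModule.lean` (P2, M3, M4). The ttrl2 lane's certificate (N1) for
`T(n;p,q) = Σ_k (−1)^k C(n,k) C(p−k,n) C(q−k,n)` (polynomial binomials; `VIM.md` §2 (b1), file
`r1b/level1_T_certificates.json`, family `n-in-p-basis`):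

  `−(p−n)(q−n)(n+1)²·T(n+1;p,q) + c₀(n,p,q)·T(n;p,q) − (p+1−n)(p−q−n)(5n²−3np−3nq+4n+2pq−p−q+1)·T(n;p+1,q) = 0`,
  `c₀ = (n+p−q+1)(−8n³+10n²p+4n²q−5n²−3np²−6npq+5np−nq−n+2p²q−p²+p−q)`,

certificate `R = −k(p+1−k)(q+1−k)φ(k)/((k−n−1)(p+1−k−n))`, i.e. in pole-free form
`G(k) = (−1)^k k(q+1−k)φ(k) C(n+1,k) C(p+1−k,n) C(q−k,n)/(n+1)` with the cubic `φ = phiN`. Replayed here for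
`n ≥ 1` (`T_rel_N1`) with the unit `(−1)^k C(n+1,k)·fallProd(n−1)(p−k)·fallProd(n−1)(q−k−1)`; together with (P2)
this makes `{T(n;p,q), T(n;p+1,q)}` a basis in which BOTH shifts `p ↦ p+1` and `n ↦ n+1` act by explicit 2×2
matrices over `ℚ(n,p,q)` — the level-1 input of the lane's level-2 certificates (R-K2, R-NK; VIM.md §7).
Second implementation: `HOME/cert-1/brown9/tmodule_check.py`. No named facts.
-/

namespace Summit.KontsevichZagierPeriods.Zeta5Search.Certificates

namespace VIMInner

open Finset
open Summit.KontsevichZagierPeriods.Zeta5Search.SymmetricRecursion (choose_succ_left_cast choose_succ_right_cast)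

/-- `fallProd (m+1) x = x · fallProd m (x−1)`. -/
theorem fallProd_succ_pred (m : ℕ) (x : ℚ) : fallProd (m + 1) x = x * fallProd m (x - 1) := by
  have h := fallProd_succ_shift m (x - 1)
  simp only [sub_add_cancel] at h
  exact h

/-- `fallProd (m+2) x = fallProd m (x−1) · x(x−1−m)`. -/
theorem fallProd_two_pred (m : ℕ) (x : ℚ) : fallProd (m + 2) x = fallProd m (x - 1) * (x * (x - 1 - m)) := by
  have h := fallProd_two_shift m (x - 1)
  simp only [sub_add_cancel] at h
  exact h

/-- The cubic `φ(k)` of the (N1) certificate: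
`k n² − k n p − k n q + k p q − 9n³ + 9n²p + 5n²q − 9n² − 2np² − 5npq + 7np + 3nq − 2n + p²q − p² − 2pq + p`. -/
def phiN (n p q k : ℚ) : ℚ :=
  k * n ^ 2 - k * n * p - k * n * q + k * p * q - 9 * n ^ 3 + 9 * n ^ 2 * p + 5 * n ^ 2 * q - 9 * n ^ 2
    - 2 * n * p ^ 2 - 5 * n * p * q + 7 * n * p + 3 * n * q - 2 * n + p ^ 2 * q - p ^ 2 - 2 * p * q + p

/-- The coefficient `c₀(n,p,q)` of `T(n;p,q)` in (N1). -/
def cN0 (n p q : ℚ) : ℚ :=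
  (n + p - q + 1) * (-8 * n ^ 3 + 10 * n ^ 2 * p + 4 * n ^ 2 * q - 5 * n ^ 2 - 3 * n * p ^ 2 - 6 * n * p * q
    + 5 * n * p - n * q - n + 2 * p ^ 2 * q - p ^ 2 + p - q)

/-- The coefficient of `T(n+1;p,q)` in (N1): `−(p−n)(q−n)(n+1)²`. -/
def cN1 (n p q : ℚ) : ℚ := -((p - n) * (q - n) * (n + 1) ^ 2)

/-- The coefficient of `T(n;p+1,q)` in (N1): `−(p+1−n)(p−q−n)(5n²−3np−3nq+4n+2pq−p−q+1)`. -/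
def cNp (n p q : ℚ) : ℚ :=
  -((p + 1 - n) * (p - q - n) * (5 * n ^ 2 - 3 * n * p - 3 * n * q + 4 * n + 2 * p * q - p - q + 1))

/-! ### Unit `(−1)^k C(m+2,k) · fallProd m (p−k) · fallProd m (q−k−1)` at `n = m+1` -/

/-- The unit of the `n`-shift relation at `n = m+1`. -/
def unitN (m : ℕ) (p q : ℚ) (k : ℕ) : ℚ :=
  (-1) ^ k * (((m + 2).choose k : ℕ) : ℚ) * fallProd m (p - k) * fallProd m (q - k - 1)

/-- `Z = (m+2)!²`. -/
def ZN (m : ℕ) : ℚ := ((m + 2).factorial : ℚ) ^ 2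

/-- `Z ≠ 0`. -/
theorem ZN_ne_zero (m : ℕ) : ZN m ≠ 0 := by unfold ZN; positivity

/-- `Z·t(n+1;p,q;k) = unit·(p−k−m)(p−k−m−1)(q−k)(q−k−m−1)`. -/
theorem ZN_tT_up (m : ℕ) (p q : ℚ) (k : ℕ) :
    ZN m * tT (m + 2) p q k =
      unitN m p q k * ((p - k - m) * (p - k - m - 1) * (q - k) * (q - k - m - 1)) := by
  unfold ZN tT bp unitN
  rw [fallProd_two m (p - k), fallProd_two_pred m (q - k)]
  field_simp
  ring

/-- `C(m+1,k) = C(m+2,k)(m+2−k)/(m+2)`. -/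
theorem choose_down (m k : ℕ) :
    (((m + 1).choose k : ℕ) : ℚ) = (((m + 2).choose k : ℕ) : ℚ) * (((m : ℚ) + 2) - k) / ((m : ℚ) + 2) := by
  have h := choose_succ_left_cast (m + 1) k
  push_cast at h
  have hm : ((m : ℚ) + 2) ≠ 0 := by positivity
  field_simp
  linear_combination -h

/-- `Z·t(n;p,q;k) = unit·(m+2−k)(m+2)(p−k−m)(q−k)`. -/
theorem ZN_tT_00 (m : ℕ) (p q : ℚ) (k : ℕ) :
    ZN m * tT (m + 1) p q k = unitN m p q k * ((((m : ℚ) + 2) - k) * ((m : ℚ) + 2) * (p - k - m) * (q - k)) := by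
  unfold ZN tT bp unitN
  rw [choose_down, fallProd_succ m (p - k), fallProd_succ_pred m (q - k), Nat.factorial_succ (m + 1)]
  push_cast
  set F1 := fallProd m (p - k)
  set F2 := fallProd m (q - k - 1)
  have hf : (((m + 1).factorial : ℕ) : ℚ) ≠ 0 := by positivity
  have hm : ((m : ℚ) + 2) ≠ 0 := by positivity
  have hm' : ((m : ℚ) + 1 + 1) ≠ 0 := by positivity
  field_simp
  ring

/-- `Z·t(n;p+1,q;k) = unit·(m+2−k)(m+2)(p+1−k)(q−k)`. -/
theorem ZN_tT_10 (m : ℕ) (p q : ℚ) (k : ℕ) :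
    ZN m * tT (m + 1) (p + 1) q k =
      unitN m p q k * ((((m : ℚ) + 2) - k) * ((m : ℚ) + 2) * (p + 1 - k) * (q - k)) := by
  unfold ZN tT bp unitN
  rw [choose_down, show p + 1 - (k : ℚ) = (p - k) + 1 by ring, fallProd_succ_shift m (p - k),
    fallProd_succ_pred m (q - k), Nat.factorial_succ (m + 1)]
  push_cast
  set F1 := fallProd m (p - k)
  set F2 := fallProd m (q - k - 1)
  have hf : (((m + 1).factorial : ℕ) : ℚ) ≠ 0 := by positivity
  have hm : ((m : ℚ) + 2) ≠ 0 := by positivity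
  have hm' : ((m : ℚ) + 1 + 1) ≠ 0 := by positivity
  field_simp
  ring

/-- The (N1) certificate at `n = m+1`: `G(k) = (−1)^k k(q+1−k)φ(k) C(m+2,k) C(p+1−k,m+1) C(q−k,m+1)/(m+2)`. -/
def certN (m : ℕ) (p q : ℚ) (k : ℕ) : ℚ :=
  (-1) ^ k * (k : ℚ) * (q + 1 - k) * phiN ((m : ℚ) + 1) p q k * (((m + 2).choose k : ℕ) : ℚ)
    * bp (m + 1) (p + 1 - k) * bp (m + 1) (q - k) / ((m : ℚ) + 2)

/-- `Z·G(k) = unit·k(q+1−k)φ(k)(m+2)(p+1−k)(q−k)`. -/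
theorem ZN_certN (m : ℕ) (p q : ℚ) (k : ℕ) :
    ZN m * certN m p q k =
      unitN m p q k * ((k : ℚ) * (q + 1 - k) * phiN ((m : ℚ) + 1) p q k * ((m : ℚ) + 2) * (p + 1 - k) * (q - k)) := by
  unfold ZN certN bp unitN
  rw [show p + 1 - (k : ℚ) = (p - k) + 1 by ring, fallProd_succ_shift m (p - k),
    fallProd_succ_pred m (q - k), Nat.factorial_succ (m + 1)]
  push_cast
  set F1 := fallProd m (p - k)
  set F2 := fallProd m (q - k - 1)
  set P := phiN ((m : ℚ) + 1) p q k
  have hf : (((m + 1).factorial : ℕ) : ℚ) ≠ 0 := by positivity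
  have hm : ((m : ℚ) + 2) ≠ 0 := by positivity
  have hm' : ((m : ℚ) + 1 + 1) ≠ 0 := by positivity
  field_simp
  ring

/-- `Z·G(k+1) = −unit·(q−k)φ(k+1)(m+2−k)(m+2)(p−k−m)(q−k−m−1)`. -/
theorem ZN_certN_succ (m : ℕ) (p q : ℚ) (k : ℕ) :
    ZN m * certN m p q (k + 1) =
      unitN m p q k * (-((q - k) * phiN ((m : ℚ) + 1) p q ((k : ℚ) + 1) * (((m : ℚ) + 2) - k) * ((m : ℚ) + 2)
        * (p - k - m) * (q - k - m - 1))) := by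
  have hk : ((k : ℚ) + 1) ≠ 0 := by positivity
  have hc : (((m + 2).choose (k + 1) : ℕ) : ℚ) = (((m + 2).choose k : ℕ) : ℚ) * (((m : ℚ) + 2) - k) / ((k : ℚ) + 1) := by
    have h := choose_succ_right_cast (m + 2) k
    push_cast at h
    field_simp
    linear_combination h
  unfold ZN certN bp unitN
  push_cast
  rw [hc, show p + 1 - ((k : ℚ) + 1) = p - k by ring, show q - ((k : ℚ) + 1) = q - k - 1 by ring,
    fallProd_succ m (p - k), fallProd_succ m (q - k - 1), Nat.factorial_succ (m + 1)]
  push_cast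
  set F1 := fallProd m (p - k)
  set F2 := fallProd m (q - k - 1)
  set P := phiN ((m : ℚ) + 1) p q ((k : ℚ) + 1)
  have hf : (((m + 1).factorial : ℕ) : ℚ) ≠ 0 := by positivity
  have hm : ((m : ℚ) + 2) ≠ 0 := by positivity
  have hm' : ((m : ℚ) + 1 + 1) ≠ 0 := by positivity
  field_simp
  ring

/-- **(N1) cleared** — the polynomial identity behind the certificate (`ring`). -/
theorem N1_cleared (M P Q K : ℚ) :
    cN1 (M + 1) P Q * ((P - K - M) * (P - K - M - 1) * (Q - K) * (Q - K - M - 1))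
      + cN0 (M + 1) P Q * (((M + 2) - K) * (M + 2) * (P - K - M) * (Q - K))
      + cNp (M + 1) P Q * (((M + 2) - K) * (M + 2) * (P + 1 - K) * (Q - K))
      = -((Q - K) * phiN (M + 1) P Q (K + 1) * ((M + 2) - K) * (M + 2) * (P - K - M) * (Q - K - M - 1))
        - K * (Q + 1 - K) * phiN (M + 1) P Q K * (M + 2) * (P + 1 - K) * (Q - K) := by
  unfold cN1 cN0 cNp phiN; ring

/-- **(N1) termwise** at `n = m+1`: `c₁ t(n+1;p,q) + c₀ t(n;p,q) + c_p t(n;p+1,q) = G(k+1) − G(k)`. -/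
theorem N1_termwise (m : ℕ) (p q : ℚ) (k : ℕ) :
    cN1 ((m : ℚ) + 1) p q * tT (m + 2) p q k + cN0 ((m : ℚ) + 1) p q * tT (m + 1) p q k
      + cNp ((m : ℚ) + 1) p q * tT (m + 1) (p + 1) q k = certN m p q (k + 1) - certN m p q k := by
  apply mul_left_cancel₀ (ZN_ne_zero m)
  have h1 := ZN_tT_up m p q k
  have h0 := ZN_tT_00 m p q k
  have hp := ZN_tT_10 m p q k
  have hG := ZN_certN m p q k
  have hG1 := ZN_certN_succ m p q k
  have hcl := N1_cleared (m : ℚ) p q (k : ℚ)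
  rw [mul_sub]
  linear_combination cN1 ((m : ℚ) + 1) p q * h1 + cN0 ((m : ℚ) + 1) p q * h0 + cNp ((m : ℚ) + 1) p q * hp
    - hG1 + hG + unitN m p q k * hcl

/-- **(N1)**: the `n`-shift of `T` in the basis `{T(n;p,q), T(n;p+1,q)}` (`n ≥ 1`):
`−(p−n)(q−n)(n+1)²·T(n+1;p,q) + c₀·T(n;p,q) − (p+1−n)(p−q−n)(5n²−3np−3nq+4n+2pq−p−q+1)·T(n;p+1,q) = 0`. -/
theorem T_rel_N1 (n : ℕ) (hn : 1 ≤ n) (p q : ℚ) :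
    cN1 n p q * T (n + 1) p q + cN0 n p q * T n p q + cNp n p q * T n (p + 1) q = 0 := by
  obtain ⟨m, rfl⟩ : ∃ m, n = m + 1 := ⟨n - 1, by omega⟩
  have htop : certN m p q (m + 3) = 0 := by simp [certN]
  have h0 : certN m p q 0 = 0 := by simp [certN]
  have h := telescope₃_eq_zero (cN1 ((m : ℚ) + 1) p q) (cN0 ((m : ℚ) + 1) p q) (cNp ((m : ℚ) + 1) p q)
    (tT (m + 2) p q) (tT (m + 1) p q) (tT (m + 1) (p + 1) q) (certN m p q) (m + 3)
    (fun k _ => N1_termwise m p q k) h0 htop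
  rw [sum_range_eq_of_vanish (tT (m + 1) p q) (by omega : m + 2 ≤ m + 3) (fun k hk => tT_eq_zero hk p q),
    sum_range_eq_of_vanish (tT (m + 1) (p + 1) q) (by omega : m + 2 ≤ m + 3)
      (fun k hk => tT_eq_zero hk (p + 1) q)] at h
  unfold T
  push_cast
  rw [show m + 1 + 1 + 1 = m + 3 by rfl, show m + 1 + 1 = m + 2 by rfl]
  linear_combination h

end VIMInner

end Summit.KontsevichZagierPeriods.Zeta5Search.Certificates
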